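import Summits.BirchSwinnertonDyer.BirchSwinnertonDyer.Theorems.ManinLocalTwoThreeEtaUnitSquareOdd
import Summits.BirchSwinnertonDyer.BirchSwinnertonDyer.Theorems.ManinLocalTwoThreeEtaUnitSquareHalf
import HarnessLib

/-!
# E-an-49⁺ `EtaUnitSquareIffEven`: an `η`-unit series is a `2`-adic square iff all exponents are even

Summit `BirchSwinnertonDyer`, route `ManinLocalTwoThree` (cell bsd-f2-manin), crux C2 `ManinOddAtFour` (stmt-BirchSwinnertonDyer-22967),
stub `stub_minimalReducibleResidual` (Rb); an g14's support theorem E-an-49⁺ (MEMO-an §56.3, HOME/an/Sketch-an-g14.lean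
`EsG…CuspidalKummer.EtaUnitSquareIffEven`), the parity test of the cuspidal-Kummer certificate E-an-52.

* `isSquare_etaUnit_of_forall_even` — `⇐`: all `r_δ` even ⟹ `g = (∏ E(q^δ)^{r_δ/2})²` already in `ℤ⟦q⟧`.
* `forall_even_of_isSquare_etaUnit` — `⇒`, by strong induction on a bound of `S`: odd scales by `even_of_isSquare_etaUnit_of_odd`
  (p609843); for the even scales write `g·Q² = P²·Φ` with `P, Q` the `η`-products over the odd scales (squares, their exponents being
  even) — then `Φ` is the unit series at the even scales, has no odd-degree terms, is a `2`-adic square, so its contraction `q² ↦ q`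
  is a `2`-adic square (`isSquare_contract_of_isSquare`) and is the unit series of the halved scales: induct.
* **`etaUnitSquareIffEven`** — the body of an's `EtaUnitSquareIffEven` with `IsEtaUnitSeries` unfolded.

No new definitions; nothing about BSD or Manin's conjecture is proved here.

References: cell memo HOME/MEMO-an.md §56.3; T. M. Apostol, GTM 41 §3.1–§3.2 [cite: Apostol1990, §3.1–§3.2].
-/

set_option autoImplicit false
set_option linter.dupNamespace false

open PowerSeries Literature.NumberTheory.EllipticCurves.ModularForms

namespace Summit.BirchSwinnertonDyer.BirchSwinnertonDyer.Theorems.ManinLocalTwoThree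

noncomputable section

section Main

/-- `(k + k)⁺ = k⁺ + k⁺` (plumbing). [folklore] -/
theorem toNat_add_self (k : ℤ) : (k + k).toNat = k.toNat + k.toNat := by omega

/-- A finite product of powers of the `E(q^δ)` has constant term `1`. [folklore] -/
theorem constantCoeff_prod_formalEulerScaled_pow (S : Finset ℕ) (n : ℕ → ℕ) :
    constantCoeff (∏ δ ∈ S, formalEulerScaled δ ^ n δ) = 1 := by
  rw [map_prod]
  exact Finset.prod_eq_one fun δ _ => by rw [map_pow, constantCoeff_formalEulerScaled, one_pow]

/-- **E-an-49⁺, `⇐`**: if all `r_δ` are even the `η`-unit series is a square (already in `ℤ⟦q⟧`, hence `2`-adically).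
[cite: Apostol1990, §3.1–§3.2] -/
theorem isSquare_etaUnit_of_forall_even (S : Finset ℕ) (r : ℕ → ℤ) (g : PowerSeries ℤ)
    (hg : constantCoeff g = 1 ∧
      g * ∏ δ ∈ S, formalEulerScaled δ ^ (-(r δ)).toNat = ∏ δ ∈ S, formalEulerScaled δ ^ (r δ).toNat)
    (heven : ∀ δ ∈ S, Even (r δ)) : IsSquare (g.map (Int.castRingHom ℤ_[2])) := by
  -- `r = k + k`
  let k : ℕ → ℤ := fun δ => r δ / 2
  have hk : ∀ δ ∈ S, r δ = k δ + k δ := fun δ hδ => by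
    have := Int.two_mul_ediv_two_of_even (heven δ hδ); simp only [k]; omega
  let P : PowerSeries ℤ := ∏ δ ∈ S, formalEulerScaled δ ^ (k δ).toNat
  let Q : PowerSeries ℤ := ∏ δ ∈ S, formalEulerScaled δ ^ (-(k δ)).toNat
  have hP : ∏ δ ∈ S, formalEulerScaled δ ^ (r δ).toNat = P ^ 2 := by
    rw [← Finset.prod_pow]
    refine Finset.prod_congr rfl fun δ hδ => ?_
    rw [← pow_mul, hk δ hδ, toNat_add_self]; ring_nf
  have hQ : ∏ δ ∈ S, formalEulerScaled δ ^ (-(r δ)).toNat = Q ^ 2 := by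
    rw [← Finset.prod_pow]
    refine Finset.prod_congr rfl fun δ hδ => ?_
    rw [← pow_mul, hk δ hδ, neg_add, toNat_add_self]; ring_nf
  have hQu : IsUnit Q := by
    rw [PowerSeries.isUnit_iff_constantCoeff]
    simp only [Q, constantCoeff_prod_formalEulerScaled_pow, isUnit_one]
  obtain ⟨u, hu⟩ := hQu
  have hid : g * Q ^ 2 = P ^ 2 := by rw [← hP, ← hQ]; exact hg.2
  have hsq : IsSquare g := by
    refine ⟨P * ↑u⁻¹, ?_⟩
    calc g = g * (Q * ↑u⁻¹) ^ 2 := by rw [← hu, Units.mul_inv, one_pow, mul_one]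
      _ = g * Q ^ 2 * (↑u⁻¹) ^ 2 := by ring
      _ = P ^ 2 * (↑u⁻¹) ^ 2 := by rw [hid]
      _ = P * ↑u⁻¹ * (P * ↑u⁻¹) := by ring
  obtain ⟨h, hh⟩ := hsq
  exact ⟨h.map (Int.castRingHom ℤ_[2]), by rw [hh, map_mul]⟩

/-- **E-an-49⁺, `⇒`** (strong induction on a bound `n` of the scales). [cite: Apostol1990, §3.1–§3.2] -/
theorem forall_even_of_isSquare_etaUnit (n : ℕ) : ∀ (S : Finset ℕ) (r : ℕ → ℤ) (g : PowerSeries ℤ),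
    (∀ δ ∈ S, δ ≤ n) → 0 ∉ S →
    (constantCoeff g = 1 ∧
      g * ∏ δ ∈ S, formalEulerScaled δ ^ (-(r δ)).toNat = ∏ δ ∈ S, formalEulerScaled δ ^ (r δ).toNat) →
    IsSquare (g.map (Int.castRingHom ℤ_[2])) → ∀ δ ∈ S, Even (r δ) := by
  induction n using Nat.strong_induction_on with
  | _ n ih =>
  intro S r g hle hS hg hsq δ hδS
  classical
  have hodd : ∀ d ∈ S, Odd d → Even (r d) := even_of_isSquare_etaUnit_of_odd S r g hS hg hsq
  rcases Nat.even_or_odd δ with hδe | hδo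
  swap
  · exact hodd δ hδS hδo
  -- even `δ`: descent to the halved even scales
  set So : Finset ℕ := S.filter fun d => Odd d with hSo
  set Se : Finset ℕ := S.filter fun d => ¬ Odd d with hSe
  have hδSe : δ ∈ Se := Finset.mem_filter.mpr ⟨hδS, Nat.not_odd_iff_even.mpr hδe⟩
  let E : ℕ → PowerSeries ℤ := formalEulerScaled
  -- the odd part is a square on both sides
  let k : ℕ → ℤ := fun d => r d / 2
  have hk : ∀ d ∈ So, r d = k d + k d := fun d hd => by
    obtain ⟨hdS, hdo⟩ := Finset.mem_filter.mp hd
    have := Int.two_mul_ediv_two_of_even (hodd d hdS hdo); simp only [k]; omega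
  let P : PowerSeries ℤ := ∏ d ∈ So, E d ^ (k d).toNat
  let Q : PowerSeries ℤ := ∏ d ∈ So, E d ^ (-(k d)).toNat
  have hP : ∏ d ∈ So, E d ^ (r d).toNat = P ^ 2 := by
    rw [← Finset.prod_pow]
    refine Finset.prod_congr rfl fun d hd => ?_
    rw [← pow_mul, hk d hd, toNat_add_self]; ring_nf
  have hQ : ∏ d ∈ So, E d ^ (-(r d)).toNat = Q ^ 2 := by
    rw [← Finset.prod_pow]
    refine Finset.prod_congr rfl fun d hd => ?_
    rw [← pow_mul, hk d hd, neg_add, toNat_add_self]; ring_nf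
  let A : PowerSeries ℤ := ∏ d ∈ Se, E d ^ (-(r d)).toNat
  let B : PowerSeries ℤ := ∏ d ∈ Se, E d ^ (r d).toNat
  have hsplitL : ∏ d ∈ S, E d ^ (-(r d)).toNat = Q ^ 2 * A := by
    rw [← hQ]; exact (Finset.prod_filter_mul_prod_filter_not S (fun d => Odd d) _).symm
  have hsplitR : ∏ d ∈ S, E d ^ (r d).toNat = P ^ 2 * B := by
    rw [← hP]; exact (Finset.prod_filter_mul_prod_filter_not S (fun d => Odd d) _).symm
  have hPu : IsUnit P := by
    rw [PowerSeries.isUnit_iff_constantCoeff]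
    simp only [P, E, constantCoeff_prod_formalEulerScaled_pow, isUnit_one]
  obtain ⟨u, hu⟩ := hPu
  -- `Φ := g Q² / P²` is the unit series at the even scales
  let Φ : PowerSeries ℤ := g * Q ^ 2 * (↑u⁻¹) ^ 2
  have hΦid : Φ * A = B := by
    have h1 : g * (Q ^ 2 * A) = P ^ 2 * B := by rw [← hsplitL, ← hsplitR]; exact hg.2
    calc Φ * A = g * (Q ^ 2 * A) * (↑u⁻¹) ^ 2 := by ring
      _ = P ^ 2 * B * (↑u⁻¹) ^ 2 := by rw [h1]
      _ = B * (P * ↑u⁻¹) ^ 2 := by ring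
      _ = B := by rw [← hu, Units.mul_inv, one_pow, mul_one]
  have hA0 : constantCoeff A = 1 := constantCoeff_prod_formalEulerScaled_pow Se _
  have hB0 : constantCoeff B = 1 := constantCoeff_prod_formalEulerScaled_pow Se _
  have hΦ0 : constantCoeff Φ = 1 := by
    have := congrArg constantCoeff hΦid
    rw [map_mul, hA0, mul_one, hB0] at this
    exact this
  have hevenSe : ∀ d ∈ Se, Even d := fun d hd => Nat.not_odd_iff_even.mp (Finset.mem_filter.mp hd).2
  have hAodd : ∀ i, Odd i → coeff i A = 0 :=
    oddVanish_prod Se _ fun d hd => oddVanish_pow (oddVanish_formalEulerScaled_of_even (hevenSe d hd)) _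
  have hBodd : ∀ i, Odd i → coeff i B = 0 :=
    oddVanish_prod Se _ fun d hd => oddVanish_pow (oddVanish_formalEulerScaled_of_even (hevenSe d hd)) _
  have hΦodd : ∀ i, Odd i → coeff i Φ = 0 := oddVanish_of_mul_eq hAodd hA0 hBodd hΦid
  -- contraction: the unit series `g'` of the halved scales
  let g' : PowerSeries ℤ := PowerSeries.mk fun m => coeff (2 * m) Φ
  let S' : Finset ℕ := Se.image fun d => d / 2
  let r' : ℕ → ℤ := fun d' => r (2 * d')
  have htwo : ∀ d ∈ Se, 2 * (d / 2) = d := fun d hd => Nat.two_mul_div_two_of_even (hevenSe d hd)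
  have hinj : Set.InjOn (fun d => d / 2) (Se : Set ℕ) := by
    intro d₁ h₁ d₂ h₂ h
    have e₁ := htwo d₁ h₁; have e₂ := htwo d₂ h₂
    simp only at h
    omega
  have hcontr : ∀ (nn : ℕ → ℕ) (nn' : ℕ → ℕ), (∀ d ∈ Se, nn d = nn' (d / 2)) →
      (PowerSeries.mk fun m => coeff (2 * m) (∏ d ∈ Se, E d ^ nn d)) = ∏ d' ∈ S', E d' ^ nn' d' := by
    intro nn nn' hnn
    rw [contract_prod Se _ (fun d hd => oddVanish_pow (oddVanish_formalEulerScaled_of_even (hevenSe d hd)) _),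
      Finset.prod_image hinj]
    refine Finset.prod_congr rfl fun d hd => ?_
    rw [contract_pow (oddVanish_formalEulerScaled_of_even (hevenSe d hd)), hnn d hd]
    congr 1
    show (PowerSeries.mk fun m => coeff (2 * m) (formalEulerScaled d)) = formalEulerScaled (d / 2)
    conv_lhs => rw [← htwo d hd]
    exact contract_formalEulerScaled_two_mul (d / 2)
  have hg' : constantCoeff g' = 1 ∧
      g' * ∏ d' ∈ S', formalEulerScaled d' ^ (-(r' d')).toNat = ∏ d' ∈ S', formalEulerScaled d' ^ (r' d').toNat := by
    refine ⟨?_, ?_⟩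
    · show constantCoeff (PowerSeries.mk fun m => coeff (2 * m) Φ) = 1
      rw [← coeff_zero_eq_constantCoeff_apply, coeff_mk, mul_zero, coeff_zero_eq_constantCoeff_apply, hΦ0]
    · have h1 : (PowerSeries.mk fun m => coeff (2 * m) (Φ * A)) = PowerSeries.mk fun m => coeff (2 * m) B := by
        rw [hΦid]
      rw [contract_mul hΦodd] at h1
      have hL := hcontr (fun d => (-(r d)).toNat) (fun d' => (-(r' d')).toNat)
        (fun d hd => by simp only [r']; rw [htwo d hd])
      have hR := hcontr (fun d => (r d).toNat) (fun d' => (r' d').toNat)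
        (fun d hd => by simp only [r']; rw [htwo d hd])
      rw [hL, hR] at h1
      exact h1
  have hS' : 0 ∉ S' := by
    intro h0
    obtain ⟨d, hd, hd0⟩ := Finset.mem_image.mp h0
    have hdS : d ∈ S := (Finset.mem_filter.mp hd).1
    have hdne : d ≠ 0 := fun h => hS (h ▸ hdS)
    have := htwo d hd
    omega
  -- the bound halves: all `d' ≤ n / 2 < n`
  have hn2 : 2 ≤ n := by
    have hδ0 : δ ≠ 0 := fun h => hS (h ▸ hδS)
    have := htwo δ hδSe
    have := hle δ hδS
    omega
  have hlt : n / 2 < n := Nat.div_lt_self (by omega) one_lt_two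
  have hle' : ∀ d' ∈ S', d' ≤ n / 2 := by
    intro d' hd'
    obtain ⟨d, hd, rfl⟩ := Finset.mem_image.mp hd'
    exact Nat.div_le_div_right (hle d (Finset.mem_filter.mp hd).1)
  -- `g'` is a `2`-adic square
  have hsq' : IsSquare (g'.map (Int.castRingHom ℤ_[2])) := by
    let ι := Int.castRingHom ℤ_[2]
    obtain ⟨H, hH⟩ := hsq
    have hΦsq : IsSquare (Φ.map ι) := by
      refine ⟨H * PowerSeries.map ι Q * PowerSeries.map ι ((u⁻¹ : (PowerSeries ℤ)ˣ) : PowerSeries ℤ), ?_⟩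
      show PowerSeries.map ι (g * Q ^ 2 * ((u⁻¹ : (PowerSeries ℤ)ˣ) : PowerSeries ℤ) ^ 2) = _
      rw [map_mul, map_mul, map_pow, map_pow, hH]; ring
    have hΦι0 : constantCoeff (Φ.map ι) = 1 := by
      rw [← coeff_zero_eq_constantCoeff_apply, coeff_map, coeff_zero_eq_constantCoeff_apply, hΦ0, map_one]
    have := isSquare_contract_of_isSquare (oddVanish_map ι hΦodd) hΦι0 hΦsq
    rw [contract_map] at this
    exact this
  -- induct
  have hIH := ih (n / 2) hlt S' r' g' hle' hS' hg' hsq' (δ / 2) (Finset.mem_image.mpr ⟨δ, hδSe, rfl⟩)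
  simp only [r'] at hIH
  rwa [htwo δ hδSe] at hIH

/-- **E-an-49⁺ `EtaUnitSquareIffEven`** (an g14, MEMO-an §56.3; the body of HOME/an/Sketch-an-g14.lean `EtaUnitSquareIffEven`
with `IsEtaUnitSeries S r g` unfolded): for `0 ∉ S` and the unit series `g ∈ 1 + qℤ⟦q⟧` of the `η`-quotient `∏_δ η(δτ)^{r_δ}`
(`g · ∏_δ E(q^δ)^{(−r_δ)⁺} = ∏_δ E(q^δ)^{(r_δ)⁺}`, `E(q^δ) = formalEulerScaled δ`), `g` is a square in `ℤ₂⟦q⟧` iff every `r_δ`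
is even. [cite: Apostol1990, §3.1–§3.2] -/
theorem etaUnitSquareIffEven :
    ∀ (S : Finset ℕ) (r : ℕ → ℤ) (g : PowerSeries ℤ), 0 ∉ S →
      (constantCoeff g = 1 ∧
        g * ∏ δ ∈ S, formalEulerScaled δ ^ (-(r δ)).toNat = ∏ δ ∈ S, formalEulerScaled δ ^ (r δ).toNat) →
      (IsSquare (g.map (Int.castRingHom ℤ_[2])) ↔ ∀ δ ∈ S, Even (r δ)) :=
  fun S r g hS hg =>
    ⟨fun hsq => forall_even_of_isSquare_etaUnit (S.sup id) S r g (fun _ hδ => Finset.le_sup (f := id) hδ) hS hg hsq,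
      isSquare_etaUnit_of_forall_even S r g hg⟩

end Main

end

end Summit.BirchSwinnertonDyer.BirchSwinnertonDyer.Theorems.ManinLocalTwoThree
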